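import Summits.Langlands.Langlands.Theses.IrreducibilityBySelfDuality
import Summits.Langlands.Langlands.Theorems.IrreducibilityBySelfDualityIrreducibleOffSectorRegularAttached
import HarnessLib

/-!
# `IrreducibleOffSector` on the regular totally-real / CM sector, on the route's declarations
(crux stmt-Langlands-14329 `IrreducibilityBySelfDuality.IrreducibleOffSector`, line `Sketch`;
`--supports` file; imports the route module, so it is NOT for use inside `closes` — the structural
statements are those of `…IrreducibleOffSectorRegularAttached`, p117071)

The structural child `isIrreducible_of_isRegular_of_galoisRep_irreducible` (p117071) takes lang.S27 as
the TEXT of the route input `GaloisRepOfRegularAlgebraic` (stmt-Langlands-10785); here it is fed with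
the route decl itself (definitionally its text), giving the regular totally-real / CM sector of the
crux in the route's own vocabulary:

* `irreducibleOffSector_of_isRegular_of_galoisRep_irreducible (i2 : GaloisRepOfRegularAlgebraic)` —
  for `K` totally real or CM and `π` L-algebraic with a regular infinity type, the conclusion of
  `IrreducibleOffSector` at `(n, K, π)` follows from the irreducibility of every semisimple `r`
  attached in the C-normalisation to a regular algebraic cuspidal `π'` on `GL_n(𝔸_K)`;
* `irreducibleOffSector_rank_three_totallyReal_of_isRegular (i2 : GaloisRepOfRegularAlgebraic)
  (hBH : isIrreducible_galoisRep_gl3_totallyReal)` — the closed region `n = 3`, `K` totally real,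
  `π` regular (Böckle–Hui 2025 Thm 1.2);
* `irreducibleOffSector_rank_two_totallyReal_of_isRegular (i2 : GaloisRepOfRegularAlgebraic)
  (h2 : galoisRep_GL2_totallyReal_irreducible)` — the closed region `n = 2`, `K` totally real,
  `π` regular (Ribet 1977 / Taylor 1995).

With `n = 1` (p79199), `n = 2` regular over every `K` (p116135, modulo `PairLBoundaryJS` and
`HeckeEigenvalueField`) and the sector theorem `IrreducibleGL3CM` (`n = 3`, `K` CM, regular), the open
content of the crux is: `n = 2` irregular; `n = 3` irregular, or regular over a field neither totally
real nor CM; `n ≥ 4` off the cases where irreducibility of `r_{ℓ,ι}(π')` is in print for every `ℓ`.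

References: Böckle–Hui 2025, Thm. 1.2; Taylor 1995, Thm. 1.1; Harris–Lan–Taylor–Thorne 2016, Thm. A;
Buzzard–Gee 2014, §5.3.
-/

noncomputable section

set_option linter.dupNamespace false

open scoped NumberField
open Filter IsDedekindDomain NumberField
open Literature.NumberTheory.Automorphic Literature.NumberTheory.GaloisRepresentations
open Summit.Langlands
open Summit.Langlands.Langlands.Theses.IrreducibilityBySelfDuality

namespace Summit.Langlands.Langlands.Theorems.IrreducibleOffSector

/-- **The regular totally-real / CM sector of `IrreducibleOffSector`, on the route decls.**  Grant
the route input `GaloisRepOfRegularAlgebraic` (lang.S27) and the irreducibility of every semisimple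
`r` attached in the C-normalisation to a regular algebraic cuspidal `π'` on `GL_n(𝔸_K)`.  Then for `K`
totally real or CM and `π` cuspidal on `GL_n(𝔸_K)`, L-algebraic with a regular infinity type, every
`ρ` Satake–Frobenius compatible with `(π, ι)` at almost all places is irreducible
(`isIrreducible_of_isRegular_of_galoisRep_irreducible`, p117071, fed with the route decl, which is
definitionally its text). [cite: HarrisLanTaylorThorneRMS2016, Thm. A] [cite: BuzzardGeeLMS2014, §5.3] -/
theorem irreducibleOffSector_of_isRegular_of_galoisRep_irreducible (i2 : GaloisRepOfRegularAlgebraic)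
    {n : ℕ} [NeZero n] {K : Type} [Field K] [NumberField K] (hK : IsTotallyReal K ∨ IsCMField K)
    {hcpt : isCompact_glFiniteIntegralLevel n K} {ℓ : ℕ} [Fact ℓ.Prime] (ι : PadicAlgCl ℓ ≃+* ℂ)
    (hirr : ∀ π' : CuspidalAutomorphicRepData n K hcpt, π'.1.IsRegularAlgebraic →
      ∀ r : FramedGaloisRep K (PadicAlgCl ℓ) n, r.toGaloisRep.IsSemisimple →
        (∀ (v : HeightOneSpectrum (𝓞 K)) (β : Multiset ℂ), π'.1.HasSatakeParamAt v β →
          ((ℓ : ℕ) : 𝓞 K) ∉ v.asIdeal →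
            r.IsUnramifiedAt v ∧ r.HasFrobCharpolyAt v (arithFrobPolyOfSatake ι v.residueCard n β)) →
        r.toGaloisRep.IsIrreducible)
    (π : CuspidalAutomorphicRepData n K hcpt) (hL : π.1.IsLAlgebraic)
    (hreg : ∃ T : InfinityType K n, π.1.HasInfinityType T ∧ T.IsRegular)
    (ρ : FramedGaloisRep K (PadicAlgCl ℓ) n)
    (hρ : ∀ᶠ v : HeightOneSpectrum (𝓞 K) in cofinite, SatakeFrobCompatibleAt ι π.1 ρ v) :
    ρ.toGaloisRep.IsIrreducible :=
  isIrreducible_of_isRegular_of_galoisRep_irreducible i2 hK ι hirr π hL hreg ρ hρ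

/-- **Closed region `n = 3`, `K` totally real, `π` regular, on the route decls** (Böckle–Hui 2025
Thm. 1.2): from the route input `GaloisRepOfRegularAlgebraic` and the named fact
`isIrreducible_galoisRep_gl3_totallyReal`, the conclusion of `IrreducibleOffSector` for every cuspidal
`π` on `GL_3` over a totally real field that is L-algebraic with a regular infinity type
(`isIrreducible_rank_three_totallyReal_of_isRegular`, p117071).
[cite: BockleHui2025, Theorem 1.2] -/
theorem irreducibleOffSector_rank_three_totallyReal_of_isRegular (i2 : GaloisRepOfRegularAlgebraic)
    (hBH : isIrreducible_galoisRep_gl3_totallyReal)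
    {K : Type} [Field K] [NumberField K] (hK : IsTotallyReal K)
    {hcpt : isCompact_glFiniteIntegralLevel 3 K}
    (π : CuspidalAutomorphicRepData 3 K hcpt) (hL : π.1.IsLAlgebraic)
    (hreg : ∃ T : InfinityType K 3, π.1.HasInfinityType T ∧ T.IsRegular)
    {ℓ : ℕ} [Fact ℓ.Prime] (ι : PadicAlgCl ℓ ≃+* ℂ) (ρ : FramedGaloisRep K (PadicAlgCl ℓ) 3)
    (hρ : ∀ᶠ v : HeightOneSpectrum (𝓞 K) in cofinite, SatakeFrobCompatibleAt ι π.1 ρ v) :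
    ρ.toGaloisRep.IsIrreducible :=
  isIrreducible_rank_three_totallyReal_of_isRegular i2 hBH hK π hL hreg ι ρ hρ

/-- **Closed region `n = 2`, `K` totally real, `π` regular, on the route decls** (Ribet 1977 /
Taylor 1995): from the route input `GaloisRepOfRegularAlgebraic` and the named fact
`galoisRep_GL2_totallyReal_irreducible`, the conclusion of `IrreducibleOffSector` for every cuspidal
`π` on `GL_2` over a totally real field that is L-algebraic with a regular infinity type
(`isIrreducible_rank_two_totallyReal_of_isRegular`, p117071). [cite: Taylor1995HMFII, Thm. 1.1] -/
theorem irreducibleOffSector_rank_two_totallyReal_of_isRegular (i2 : GaloisRepOfRegularAlgebraic)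
    (h2 : galoisRep_GL2_totallyReal_irreducible)
    {K : Type} [Field K] [NumberField K] (hK : IsTotallyReal K)
    {hcpt : isCompact_glFiniteIntegralLevel 2 K}
    (π : CuspidalAutomorphicRepData 2 K hcpt) (hL : π.1.IsLAlgebraic)
    (hreg : ∃ T : InfinityType K 2, π.1.HasInfinityType T ∧ T.IsRegular)
    {ℓ : ℕ} [Fact ℓ.Prime] (ι : PadicAlgCl ℓ ≃+* ℂ) (ρ : FramedGaloisRep K (PadicAlgCl ℓ) 2)
    (hρ : ∀ᶠ v : HeightOneSpectrum (𝓞 K) in cofinite, SatakeFrobCompatibleAt ι π.1 ρ v) :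
    ρ.toGaloisRep.IsIrreducible :=
  isIrreducible_rank_two_totallyReal_of_isRegular i2 h2 hK π hL hreg ι ρ hρ

end Summit.Langlands.Langlands.Theorems.IrreducibleOffSector

end
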